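import Summits.HubbardSuperconductivity.HubbardSuperconductivity.Theorems.AposterioriCapRgSeededBrokenRegimeBoseFermiPinnedEffActionStep

/-!
# One RG integration step along a GENERAL differentiable covariance path
# (crux `SeededBrokenRegimeBoseFermiPinned` = stmt-HubbardSuperconductivity-14047, route AposterioriCapRg; supports, lead c4)

The path version of `EffActionStep.legKernelNorm_effAction_step_le` (registered stub `stub_effActionPathStepLe`): the
covariance path `s ↦ C_s` is only assumed entrywise differentiable on `[s₀, s₁]` with derivative `C'_s` obeying the
loop-line bound `‖C'_s X Y‖ ≤ c·wt X·wt Y` and the tree-line bound `‖C'_s X Y‖ ≤ wt X·wt Y·D X Y`, `εΣD ≤ cD`,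
uniformly in `s`.  This is the form the MODEL supplies: the seed path `h ↦ hubbardCovAboveCT … h …`
(`hasDerivAt_hubbardCovAboveCT_seed`, `seedFlow_hubbardEffectiveActionCT`) and the scale path
(`hasDerivAt_hubbardCovAboveCT_scale`, `scaleFlow_hubbardEffectiveActionCT`) are rational, not linear, in the flow
parameter.  Conclusion, from a priori bounds `‖(𝒢_s)_j‖_{wt,ε} ≤ N_j` on the path:

  `‖(𝒢_{s₁} − 𝒢_{s₀})_{m+1}‖_{wt,ε} ≤ (s₁ − s₀)·[((m+3)(m+2)/2)·c·N_{m+3} + ½·cD·Σ_{a+b=m+1}(a+1)(b+1)N_{a+1}N_{b+1}]`.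

Sources: M. Salmhofer, *Renormalization* (1999), §4.4; CMP 194 (1998) 249, §4.1 Lemma 1 [`Salmhofer1998`].  Folklore assembly.
-/

set_option linter.dupNamespace false -- `Summit.<S>.<S>` doubles the summit name (tree convention)

namespace Summit.HubbardSuperconductivity.HubbardSuperconductivity.Theorems.AposterioriCapRgSeededBrokenRegimeBoseFermiPinned

open Literature.MathematicalPhysics.QuantumLattice GrassmannAlgebra

namespace EffActionPathStep

variable {Γ : Type} [Fintype Γ] [DecidableEq Γ]

/-- **One RG integration step along a differentiable covariance path** (labels in `Type`, scalars `ℂ`): see the module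
docstring. [cite: Salmhofer1999, §4.4] -/
theorem legKernelNorm_effAction_path_step_le {wt : Γ → ℝ} (hwt : ∀ X, 0 ≤ wt X) {ε : ℝ} (hε : 0 < ε)
    (C C' : ℝ → Matrix Γ Γ ℂ) {s₀ s₁ : ℝ} (hs : s₀ ≤ s₁)
    (hCd : ∀ s ∈ Set.Icc s₀ s₁, ∀ X Y, HasDerivAt (fun t => C t X Y) (C' s X Y) s)
    {V : GrassmannAlgebra ℂ Γ} (hVe : V ∈ GrassmannAlgebra.evenOdd ℂ 0)
    (hZ : ∀ s ∈ Set.Icc s₀ s₁, effPartitionFn ℂ (C s) V ≠ 0)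
    {c : ℝ} (hc : 0 ≤ c) (hCc : ∀ s ∈ Set.Icc s₀ s₁, ∀ X Y, ‖C' s X Y‖ ≤ c * (wt X * wt Y))
    (D : Γ → Γ → ℝ) (hD : ∀ X Y, 0 ≤ D X Y) (hCD : ∀ s ∈ Set.Icc s₀ s₁, ∀ X Y, ‖C' s X Y‖ ≤ wt X * wt Y * D X Y)
    {cD : ℝ} (hcD : 0 ≤ cD) (hR : ∀ X, ε * ∑ Y, D X Y ≤ cD) (hCo : ∀ Y, ε * ∑ X, D X Y ≤ cD)
    (N : ℕ → ℝ)
    (hN : ∀ s ∈ Set.Icc s₀ s₁, ∀ j, legKernelNorm wt ε j (weightedKernel ε (effAction ℂ (C s) V) j) ≤ N j)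
    (m : ℕ) :
    legKernelNorm wt ε (m + 1) (weightedKernel ε (effAction ℂ (C s₁) V - effAction ℂ (C s₀) V) (m + 1)) ≤
      (s₁ - s₀) * (((m + 3) * (m + 2) / 2 : ℝ) * c * N (m + 3) +
        (1 / 2 : ℝ) * (cD * ∑ a ∈ Finset.range (m + 2), ∑ b ∈ Finset.range (m + 2),
          (if a + b = m + 1 then ((a + 1) * (b + 1) : ℝ) * (N (a + 1) * N (b + 1)) else 0))) := by
  -- the effective action along the path and the right-hand side of Polchinski's equation
  set 𝒢 : ℝ → GrassmannAlgebra ℂ Γ := fun s => effAction ℂ (C s) V with h𝒢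
  set Rf : ℝ → GrassmannAlgebra ℂ Γ := fun s =>
    grassmannLaplacian ℂ (C' s) (𝒢 s) -
      (1 / 2 : ℂ) • ∑ X, ∑ Y, C' s X Y • (grassmannDeriv ℂ X (𝒢 s) * grassmannDeriv ℂ Y (𝒢 s)) +
      (constPart ℂ (grassmannLaplacian ℂ (C' s) (effBoltzmann ℂ (C s) V)) / effPartitionFn ℂ (C s) V) • 1 with hRf
  have hder : ∀ s ∈ Set.Icc s₀ s₁, ∀ φ : GrassmannAlgebra ℂ Γ →ₗ[ℂ] ℂ,
      HasDerivAt (fun t => φ (𝒢 t)) (φ (Rf s)) s :=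
    fun s hs φ => hasDerivAt_apply_effAction C (C' s) s (hCd s hs) hVe (hZ s hs) φ
  have hN0 : ∀ s ∈ Set.Icc s₀ s₁, ∀ j, 0 ≤ N j :=
    fun s hs j => (legKernelNorm_nonneg hwt hε.le j _).trans (hN s hs j)
  set Bv : ℝ := ((m + 3) * (m + 2) / 2 : ℝ) * c * N (m + 3) +
    (1 / 2 : ℝ) * (cD * ∑ a ∈ Finset.range (m + 2), ∑ b ∈ Finset.range (m + 2),
      (if a + b = m + 1 then ((a + 1) * (b + 1) : ℝ) * (N (a + 1) * N (b + 1)) else 0)) with hBv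
  have hB : ∀ s ∈ Set.Icc s₀ s₁, legKernelNorm wt ε (m + 1) (weightedKernel ε (Rf s) (m + 1)) ≤ Bv := by
    intro s hs
    have hsplit : weightedKernel ε (Rf s) (m + 1) =
        weightedKernel ε (grassmannLaplacian ℂ (C' s) (𝒢 s)) (m + 1) +
          (-(1 / 2 : ℂ)) • weightedKernel ε
            (∑ X, ∑ Y, C' s X Y • (grassmannDeriv ℂ X (𝒢 s) * grassmannDeriv ℂ Y (𝒢 s))) (m + 1) := by
      rw [hRf]
      simp only []
      rw [EffActionStep.weightedKernel_add, EffActionStep.weightedKernel_smul_one_succ, add_zero,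
        EffActionStep.weightedKernel_sub, EffActionStep.weightedKernel_smul, sub_eq_add_neg, ← neg_smul]
    rw [hsplit]
    refine (LegKernelNormAlgebra.legKernelNorm_add_le hwt hε.le _ _ _).trans (add_le_add ?_ ?_)
    · refine (LaplacianNormBound.legKernelNorm_laplacian_le hwt hε (C' s) c (hCc s hs) (𝒢 s) m).trans ?_
      exact mul_le_mul_of_nonneg_left (hN s hs (m + 3)) (mul_nonneg (by positivity) hc)
    · rw [LegKernelNormSmul.legKernelNorm_smul, norm_neg]
      have hhalf : ‖(1 / 2 : ℂ)‖ = (1 / 2 : ℝ) := by simp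
      rw [hhalf]
      refine mul_le_mul_of_nonneg_left ?_ (by norm_num)
      refine (PolchinskiBilinearBound.legKernelNorm_polchinskiBilinear_le hwt hε (C' s) D hD (hCD s hs) cD hR hCo
        (𝒢 s) (𝒢 s) m).trans (mul_le_mul_of_nonneg_left ?_ hcD)
      refine Finset.sum_le_sum fun a _ => Finset.sum_le_sum fun b _ => ?_
      split_ifs
      · exact mul_le_mul_of_nonneg_left (mul_le_mul (hN s hs (a + 1)) (hN s hs (b + 1))
          (legKernelNorm_nonneg hwt hε.le _ _) (hN0 s hs (a + 1))) (by positivity)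
      · exact le_rfl
  exact FlowStep.legKernelNorm_increment_le hwt hε.le 𝒢 Rf hs hder (m + 1) hB

end EffActionPathStep

/-! ### The registered stub -/

/-- **W11 (`stub_effActionPathStepLe`) — one RG integration step along a differentiable covariance path**: the path
form of `stub_effActionStepLe` (entrywise differentiable `C_s` with loop-line and tree-line bounds on `C'_s` uniform in `s`;
the form the model's seed and scale paths supply). [cite: Salmhofer1999, §4.4] -/
theorem stub_effActionPathStepLe :
    ∀ {Γ : Type} [Fintype Γ] [DecidableEq Γ] (wt : Γ → ℝ), (∀ X, 0 ≤ wt X) → ∀ {ε : ℝ}, 0 < ε →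
      ∀ (C C' : ℝ → Matrix Γ Γ ℂ) (s₀ s₁ : ℝ), s₀ ≤ s₁ →
        (∀ s ∈ Set.Icc s₀ s₁, ∀ X Y, HasDerivAt (fun t => C t X Y) (C' s X Y) s) →
        ∀ (V : GrassmannAlgebra ℂ Γ), V ∈ GrassmannAlgebra.evenOdd ℂ 0 →
        (∀ s ∈ Set.Icc s₀ s₁, effPartitionFn ℂ (C s) V ≠ 0) →
        ∀ (c : ℝ), 0 ≤ c → (∀ s ∈ Set.Icc s₀ s₁, ∀ X Y, ‖C' s X Y‖ ≤ c * (wt X * wt Y)) →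
        ∀ (D : Γ → Γ → ℝ), (∀ X Y, 0 ≤ D X Y) → (∀ s ∈ Set.Icc s₀ s₁, ∀ X Y, ‖C' s X Y‖ ≤ wt X * wt Y * D X Y) →
        ∀ (cD : ℝ), 0 ≤ cD → (∀ X, ε * ∑ Y, D X Y ≤ cD) → (∀ Y, ε * ∑ X, D X Y ≤ cD) →
        ∀ (N : ℕ → ℝ), (∀ s ∈ Set.Icc s₀ s₁, ∀ j : ℕ,
            legKernelNorm wt ε j (weightedKernel ε (effAction ℂ (C s) V) j) ≤ N j) →
        ∀ m : ℕ,
          legKernelNorm wt ε (m + 1) (weightedKernel ε (effAction ℂ (C s₁) V - effAction ℂ (C s₀) V) (m + 1)) ≤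
            (s₁ - s₀) * (((m + 3) * (m + 2) / 2 : ℝ) * c * N (m + 3) +
              (1 / 2 : ℝ) * (cD * ∑ a ∈ Finset.range (m + 2), ∑ b ∈ Finset.range (m + 2),
                (if a + b = m + 1 then ((a + 1) * (b + 1) : ℝ) * (N (a + 1) * N (b + 1)) else 0))) := by
  intro Γ _ _ wt hwt ε hε C C' s₀ s₁ hs hCd V hVe hZ c hc hCc D hD hCD cD hcD hR hCo N hN m
  exact EffActionPathStep.legKernelNorm_effAction_path_step_le hwt hε C C' hs hCd hVe hZ hc hCc D hD hCD hcD hR hCo N hN m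

end Summit.HubbardSuperconductivity.HubbardSuperconductivity.Theorems.AposterioriCapRgSeededBrokenRegimeBoseFermiPinned
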